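import Summits.Schanuel.Schanuel.Theorems.ZilberEacParamCurveRoot
import Summits.Schanuel.Schanuel.Theorems.ZilberEacGraphCurveEscape
import HarnessLib

/-!
# Polynomially parametrised base curves, III: the directional escape engine

HONEST FRAMING.  Cell `pub-schanuel` (Zilber's Exponential-Algebraic Closedness, case ladder;
host summit Schanuel), seat 2, gen 19.  The analytic engine of the theorem "polynomial curve
`C = {(g₀(t), g₁(t))}` × ARBITRARY irreducible plane curve has Zariski-dense exponential points"
(`ZilberEacParamCurveDensity`), an instance class of Mantova–Masser's OPEN density question
(PLMS 2024, §1 p. 5).  NOT Schanuel's conjecture (neither used nor implied; EAC ⇏ SC); `EC(3,2)`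
stays OPEN.

THE ENGINE (`exists_escape_zeros_dir`), the directional form of gen 16's `exists_escape_zeros`.
Let `R ∈ ℂ[t]` have degree `d ≥ 2` and let `ω` be a root direction of `R` (`lc(R) ω^d = ±2πi`);
let `G ∈ ℂ[t]` have degree `m ≥ 1` with `Re(lc(G) ω^m) < 0`; let `Q ∈ ℂ[u]` be non-constant with
`Q(0) ≠ 0`; and let `E` be entire with `‖E(t)‖ ≤ C_B e^{δ Re G(t)}` whenever `Re G(t) ≤ 0` and
`|Re R(t)| ≤ B`.  Then `Q(e^{R(t)}) + E(t)` has zeros `t_k` with `Re G(t_k) ≤ -L_k`,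
`‖G(t_k)‖ ≤ A L_k`, `L_k → ∞`: along the zeros the coordinate `G` degenerates polynomially
(`|Re G(t_k)| / log(2 + ‖G(t_k)‖) → ∞`, `tendsto_abs_re_div_log_of_escape`).  Over a graph base
(`g₀ = t`, `G = X`, `Re ω < 0`) this is exactly gen 16's engine.

Proof.  Stage `k`: the exact root `z₀ = (k+1) ω e^{ζ/d}` of `R(z₀) = 2πi N_k + log θ` of file II
(`‖ζ‖ = O(1/k)`), so `e^{R(z₀)} = θ`; in gen 16's local coordinate `z = z₀ e^{u/(dT')}`
(`ZilberEacGraphCurveEscapeLocal`: `‖z - z₀‖ ≤ 1`, `e^{R(z)} = θ e^{u + Rem}`, `‖Rem‖ ≤ K/‖z₀‖`) the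
function converges to `Q(θ e^{u})` uniformly on `‖u‖ ≤ 1` because on the unit disc around `z₀`
file II gives `Re G ≤ -(A₀/2)(k+1)^m → -∞` (`A₀ = -Re(lc(G) ω^m) > 0`), whence `E → 0`; Hurwitz
persistence (`eventually_exists_zero_of_unif_approx`) yields the zeros.
-/

noncomputable section

open Filter Topology Metric Set Complex Polynomial
open Literature.ModelTheory.Zilber

set_option linter.dupNamespace false

namespace Summit.Schanuel.Schanuel.Theorems

/-- **The directional escape engine.**  See the module docstring. (new) -/
theorem exists_escape_zeros_dir (R Q G : Polynomial ℂ) (hd : 2 ≤ R.natDegree)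
    (hQ0 : Q.eval 0 ≠ 0) (hQd : 0 < Q.natDegree) (hm : 1 ≤ G.natDegree) (ω : ℂ) (s : ℤ)
    (hs : s = 1 ∨ s = -1) (hω : R.leadingCoeff * ω ^ R.natDegree = 2 * Real.pi * I * s)
    (hdir : (G.leadingCoeff * ω ^ G.natDegree).re < 0)
    (E : ℂ → ℂ) (hE : Differentiable ℂ E) {δ : ℝ} (hδ : 0 < δ)
    (hEb : ∀ B : ℝ, ∃ C : ℝ, 0 ≤ C ∧
      ∀ t : ℂ, (G.eval t).re ≤ 0 → |(R.eval t).re| ≤ B →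
        ‖E t‖ ≤ C * Real.exp (δ * (G.eval t).re)) :
    ∃ (t : ℕ → ℂ) (L : ℕ → ℝ) (A : ℝ), Tendsto L atTop atTop ∧
      ∀ k, Q.eval (exp (R.eval (t k))) + E (t k) = 0 ∧ (G.eval (t k)).re ≤ -L k ∧
        ‖G.eval (t k)‖ ≤ A * L k := by
  -- notation and a nonzero root `θ` of `Q`
  set d : ℕ := R.natDegree with hd_def
  set a : ℂ := R.leadingCoeff with ha_def
  set ℓ : Polynomial ℂ := R.eraseLead with hℓ_def
  obtain ⟨m, hm_def⟩ : ∃ m : ℕ, m = G.natDegree := ⟨_, rfl⟩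
  obtain ⟨b, hb_def⟩ : ∃ b : ℂ, b = G.leadingCoeff := ⟨_, rfl⟩
  rw [← hm_def, ← hb_def] at hdir
  rw [← hm_def] at hm
  have hd0 : d ≠ 0 := by omega
  have hd1 : 1 ≤ d := by omega
  have hR0 : R ≠ 0 := by
    rintro rfl
    rw [hd_def, Polynomial.natDegree_zero] at hd
    omega
  have ha0 : a ≠ 0 := Polynomial.leadingCoeff_ne_zero.2 hR0
  have hapos : 0 < ‖a‖ := norm_pos_iff.2 ha0
  obtain ⟨θ, hθ⟩ := Complex.exists_root (Polynomial.natDegree_pos_iff_degree_pos.1 hQd)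
  have hθ0 : θ ≠ 0 := by
    rintro rfl
    exact hQ0 hθ
  set c₀ : ℂ := Complex.log θ with hc₀_def
  have hc₀ : exp c₀ = θ := Complex.exp_log hθ0
  -- the direction is nonzero
  have hrhs : (2 * Real.pi * I * s : ℂ) ≠ 0 := by
    have hsC : (s : ℂ) ≠ 0 := by rcases hs with rfl | rfl <;> simp
    have hπ : (Real.pi : ℂ) ≠ 0 := Complex.ofReal_ne_zero.mpr Real.pi_pos.ne'
    simp [hsC, hπ, Complex.I_ne_zero]
  have hω0 : ω ≠ 0 := by
    rintro rfl
    rw [zero_pow (by omega), mul_zero] at hω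
    exact hrhs hω.symm
  have hωpos : 0 < ‖ω‖ := norm_pos_iff.mpr hω0
  -- the limit function `h(u) = Q(θ e^u)`
  set h : ℂ → ℂ := fun u => Q.eval (θ * exp u) with hh_def
  have hh : Differentiable ℂ h :=
    (Polynomial.differentiable Q).comp ((differentiable_const θ).mul differentiable_exp)
  have hh0 : h 0 = 0 := by
    simp only [hh_def, Complex.exp_zero, mul_one]; exact hθ
  have hhne : ∃ u, h u ≠ 0 := by
    by_contra hall
    push Not at hall
    have hinf : Set.Infinite {x : ℂ | Q.IsRoot x} := by
      have hinj : Function.Injective (fun t : ℝ => θ * exp (t : ℂ)) := by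
        intro t₁ t₂ ht
        have h1 : exp (t₁ : ℂ) = exp (t₂ : ℂ) := mul_left_cancel₀ hθ0 ht
        have h2 : Real.exp t₁ = Real.exp t₂ := by
          have := congrArg norm h1
          rwa [Complex.norm_exp, Complex.norm_exp, Complex.ofReal_re, Complex.ofReal_re] at this
        exact Real.exp_injective h2
      have hsub : Set.range (fun t : ℝ => θ * exp (t : ℂ)) ⊆ {x : ℂ | Q.IsRoot x} := by
        rintro _ ⟨t, rfl⟩
        exact hall t
      exact (Set.infinite_range_of_injective hinj).mono hsub
    exact (Polynomial.ne_zero_of_natDegree_gt hQd) (Polynomial.eq_zero_of_infinite_isRoot Q hinf)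
  -- constants
  set C₁ : ℝ := coeffNormSum ℓ * (3 * ‖ω‖ + 1) ^ (d - 1) + ‖c₀‖ with hC₁
  have hC₁0 : 0 ≤ C₁ := by have := coeffNormSum_nonneg ℓ; positivity
  set K₁ : ℝ := C₁ / Real.pi with hK₁
  have hK₁0 : 0 ≤ K₁ := div_nonneg hC₁0 Real.pi_pos.le
  set A₀ : ℝ := -(b * ω ^ m).re with hA₀_def
  have hA₀ : 0 < A₀ := by rw [hA₀_def]; linarith
  set K₂ : ℝ := 2 * m * K₁ * ‖b‖ * ‖ω‖ ^ m +
    (m * ‖b‖ + coeffNormSum G.eraseLead) * (3 * ‖ω‖ + 1) ^ (m - 1) with hK₂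
  set K₃ : ℝ := coeffNormSum G * (3 * ‖ω‖ + 1) ^ m with hK₃
  have hK₃0 : 0 ≤ K₃ := by have := coeffNormSum_nonneg G; positivity
  -- stage sizes and eventual conditions
  set Λ : ℕ → ℝ := fun k => ((k : ℝ) + 1) * ‖ω‖ with hΛ_def
  have hk1 : Tendsto (fun k : ℕ => (k : ℝ) + 1) atTop atTop := tendsto_natCast_add_atTop 1
  have hΛ : Tendsto Λ atTop atTop := hk1.atTop_mul_const hωpos
  set Λ' : ℕ → ℝ := fun k => A₀ / 2 * ((k : ℝ) + 1) ^ m with hΛ'_def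
  have hΛ' : Tendsto Λ' atTop atTop :=
    (tendsto_pow_atTop (by omega : m ≠ 0) |>.comp hk1).const_mul_atTop (half_pos hA₀)
  have hev₁ : ∀ᶠ k : ℕ in atTop, 32 * C₁ ≤ 2 * Real.pi * ((k : ℝ) + 1) :=
    (hk1.const_mul_atTop (by positivity : (0 : ℝ) < 2 * Real.pi)).eventually_ge_atTop _
  have hev₂ : ∀ᶠ k : ℕ in atTop, 3 ≤ Λ k := hΛ.eventually_ge_atTop 3
  have hev₃ : ∀ᶠ k : ℕ in atTop, 6 ≤ ‖a‖ * Λ k := (hΛ.const_mul_atTop hapos).eventually_ge_atTop 6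
  have hev₄ : ∀ᶠ k : ℕ in atTop, (m : ℝ) * K₁ ≤ (k : ℝ) + 1 := hk1.eventually_ge_atTop _
  have hev₅ : ∀ᶠ k : ℕ in atTop, 2 * K₂ ≤ A₀ * ((k : ℝ) + 1) :=
    (hk1.const_mul_atTop hA₀).eventually_ge_atTop _
  obtain ⟨K₀, hK₀⟩ := eventually_atTop.1 (hev₁.and (hev₂.and (hev₃.and (hev₄.and hev₅))))
  -- the roots `z₀(j)` at stage `j + K₀`
  have hroot : ∀ j : ℕ, ∃ z₀ : ℂ, exp (R.eval z₀) = θ ∧ (R.eval z₀).re = Real.log ‖θ‖ ∧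
      1 ≤ ‖z₀‖ ∧ 2 ≤ ‖a‖ * ‖z₀‖ ∧ Λ (j + K₀) / 3 ≤ ‖z₀‖ ∧
      (∀ z : ℂ, ‖z - z₀‖ ≤ 1 → (G.eval z).re ≤ -Λ' (j + K₀) ∧
        ‖G.eval z‖ ≤ K₃ * (((j + K₀ : ℕ) : ℝ) + 1) ^ m) := by
    intro j
    obtain ⟨h1, h2, h3, h4, h5⟩ := hK₀ (j + K₀) (Nat.le_add_left _ _)
    obtain ⟨ζ, hζ, hζK, hz₀⟩ := exists_alRoot_dir R hd ω s hs hω c₀ (j + K₀)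
      (by rw [← hd_def, ← hℓ_def, ← hC₁]; exact h1)
    rw [← hd_def, ← hℓ_def, ← hC₁] at hζK
    have hkk0 : (0 : ℝ) ≤ ((j + K₀ : ℕ) : ℝ) := Nat.cast_nonneg _
    have hkkpos : (0 : ℝ) < ((j + K₀ : ℕ) : ℝ) + 1 := by linarith
    have hζK' : ‖ζ‖ ≤ K₁ / (((j + K₀ : ℕ) : ℝ) + 1) := by
      rw [hK₁, div_div]; exact hζK
    have hζm : (G.natDegree : ℝ) * ‖ζ‖ ≤ 1 := by
      rw [← hm_def]
      calc (m : ℝ) * ‖ζ‖ ≤ (m : ℝ) * (K₁ / (((j + K₀ : ℕ) : ℝ) + 1)) :=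
            mul_le_mul_of_nonneg_left hζK' (Nat.cast_nonneg m)
        _ = (m : ℝ) * K₁ / (((j + K₀ : ℕ) : ℝ) + 1) := by ring
        _ ≤ 1 := by rw [div_le_one hkkpos]; exact h4
    obtain ⟨hup, hlow⟩ := norm_ray_point_bounds ω hd1 (j + K₀) hζ
    have hΛk : Λ (j + K₀) = (((j + K₀ : ℕ) : ℝ) + 1) * ‖ω‖ := rfl
    refine ⟨(((j + K₀ : ℕ) : ℂ) + 1) * ω * exp (ζ / d), ?_, ?_, ?_, ?_, ?_, fun z hz => ⟨?_, ?_⟩⟩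
    · rw [hz₀, Complex.exp_add, Complex.exp_int_mul_two_pi_mul_I, one_mul, hc₀]
    · rw [hz₀, Complex.add_re, gce_re_intCast_mul_two_pi_I, zero_add, hc₀_def, Complex.log_re]
    · rw [hΛk] at h2; push_cast at hlow h2 ⊢; linarith
    · rw [hΛk] at h3; push_cast at hlow h3 ⊢
      have := mul_le_mul_of_nonneg_left hlow hapos.le
      linarith
    · rw [hΛk]; push_cast at hlow ⊢; linarith
    · have hmain := re_eval_near_ray_le G (hm_def ▸ hm) ω hd1 (K₁ := K₁) (j + K₀) hζ hζK' hζm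
        (by push_cast at hz ⊢; exact hz)
      rw [← hm_def, ← hb_def, ← hK₂] at hmain
      have hre : (b * ω ^ m).re = -A₀ := by rw [hA₀_def]; ring
      rw [hre] at hmain
      show (G.eval z).re ≤ -(A₀ / 2 * (((j + K₀ : ℕ) : ℝ) + 1) ^ m)
      set kk : ℝ := ((j + K₀ : ℕ) : ℝ) + 1 with hkk
      have hkkm : kk ^ m = kk * kk ^ (m - 1) := by
        rw [← pow_succ', Nat.sub_add_cancel hm]
      have hpow0 : (0 : ℝ) ≤ kk ^ (m - 1) := by positivity
      have h5' : K₂ ≤ A₀ / 2 * kk := by linarith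
      have hK₂le : K₂ * kk ^ (m - 1) ≤ (A₀ / 2 * kk) * kk ^ (m - 1) :=
        mul_le_mul_of_nonneg_right h5' hpow0
      have e : (A₀ / 2 * kk) * kk ^ (m - 1) = A₀ / 2 * kk ^ m := by rw [hkkm]; ring
      linarith
    · have := norm_eval_near_ray_le G ω hd1 (j + K₀) hζ (by push_cast at hz ⊢; exact hz)
      rw [← hm_def, ← hK₃] at this
      exact this
  choose z₀ hz₀θ hz₀re hz₀1 hz₀2 hz₀low hz₀G using hroot
  -- the remainder constant
  set K : ℝ := 1 / ‖a‖ + coeffNormSum ℓ * ((d - 1 : ℕ) : ℝ) * 2 ^ (d - 1) / ‖a‖ with hK_def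
  -- the local coordinates `φ_j(u) = z₀(j) e^{u/(d T'_j)}` (explicit, no definition)
  set φ : ℕ → ℂ → ℂ := fun j u =>
    z₀ j * exp (u / ((R.natDegree : ℂ) * (R.leadingCoeff * z₀ j ^ R.natDegree))) with hφ_def
  have hRem : ∀ j (u : ℂ), ‖u‖ ≤ 1 → ‖R.eval (φ j u) - R.eval (z₀ j) - u‖ ≤ K / ‖z₀ j‖ :=
    fun j u hu => norm_gceRem_le hd (hz₀1 j) (hz₀2 j) hu
  have hdisp : ∀ j (u : ℂ), ‖u‖ ≤ 1 → ‖φ j u - z₀ j‖ ≤ 1 := fun j u hu => by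
    obtain ⟨h1, h2⟩ := norm_gcePhi_sub_le (R := R) (z₀ := z₀ j) hd (hz₀1 j) (hz₀2 j) hu
    exact h1.trans h2
  have hz₀norm : Tendsto (fun j => ‖z₀ j‖) atTop atTop := by
    refine tendsto_atTop_mono (fun j => hz₀low j)
      (((hΛ.comp (tendsto_add_atTop_nat K₀)).atTop_div_const (by norm_num : (0 : ℝ) < 3)))
  -- the rescaled functions `F_j(u) = g(φ_j(u))`
  set F : ℕ → ℂ → ℂ := fun j u => Q.eval (exp (R.eval (φ j u))) + E (φ j u) with hF_def
  have hFdiff : ∀ j, Differentiable ℂ (F j) := by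
    intro j
    have hφ : Differentiable ℂ (φ j) := differentiable_gcePhi R (z₀ j)
    exact ((Polynomial.differentiable Q).comp (((Polynomial.differentiable R).comp hφ).cexp)).add
      (hE.comp hφ)
  -- the key identity `e^{R(φ u)} = θ e^{u + Rem u}`
  have hkey : ∀ j (u : ℂ), exp (R.eval (φ j u)) =
      θ * exp (u + (R.eval (φ j u) - R.eval (z₀ j) - u)) := by
    intro j u
    rw [← hz₀θ j, ← Complex.exp_add]
    congr 1
    ring
  -- uniform approximation on `closedBall 0 1`
  obtain ⟨C, hC0, hC⟩ := hEb (|Real.log ‖θ‖| + 2)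
  have hunif : ∀ η : ℝ, 0 < η → ∀ᶠ j in atTop, ∀ u ∈ closedBall (0 : ℂ) 1, ‖F j u - h u‖ < η := by
    intro η hη
    obtain ⟨β, hβ, hβh⟩ := Metric.uniformContinuousOn_iff.1
      ((isCompact_closedBall (0 : ℂ) 2).uniformContinuousOn_of_continuous hh.continuous.continuousOn)
      (η / 2) (half_pos hη)
    have hevR : ∀ᶠ j in atTop, K / ‖z₀ j‖ < min β 1 :=
      (tendsto_const_nhds.div_atTop hz₀norm).eventually (gt_mem_nhds (lt_min hβ zero_lt_one))
    have hevE : ∀ᶠ j in atTop, C * Real.exp (-(δ * Λ' (j + K₀))) < η / 2 := by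
      have h1 : Tendsto (fun j => -(δ * Λ' (j + K₀))) atTop atBot :=
        tendsto_neg_atTop_atBot.comp (((hΛ'.comp (tendsto_add_atTop_nat K₀))).const_mul_atTop hδ)
      have h3 : Tendsto (fun j => C * Real.exp (-(δ * Λ' (j + K₀)))) atTop (𝓝 (C * 0)) :=
        (Real.tendsto_exp_atBot.comp h1).const_mul C
      rw [mul_zero] at h3
      exact h3.eventually (gt_mem_nhds (half_pos hη))
    filter_upwards [hevR, hevE] with j hjR hjE u hu
    rw [mem_closedBall, dist_zero_right] at hu
    set ρ : ℂ := R.eval (φ j u) - R.eval (z₀ j) - u with hρ_def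
    have hRem1 : ‖ρ‖ < min β 1 := (hRem j u hu).trans_lt hjR
    have hRemβ : ‖ρ‖ < β := hRem1.trans_le (min_le_left _ _)
    have hRem1' : ‖ρ‖ ≤ 1 := (hRem1.trans_le (min_le_right _ _)).le
    -- the `Q`-term
    have hQterm : ‖Q.eval (exp (R.eval (φ j u))) - h u‖ < η / 2 := by
      rw [hkey]
      have hmem1 : u + ρ ∈ closedBall (0 : ℂ) 2 := by
        rw [mem_closedBall, dist_zero_right]
        exact (norm_add_le _ _).trans (by linarith)
      have hmem2 : u ∈ closedBall (0 : ℂ) 2 := by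
        rw [mem_closedBall, dist_zero_right]; linarith
      have hdist : dist (u + ρ) u < β := by
        rw [dist_eq_norm, add_sub_cancel_left]; exact hRemβ
      have := hβh _ hmem1 _ hmem2 hdist
      rwa [dist_eq_norm] at this
    -- the `E`-term
    have hEterm : ‖E (φ j u)‖ < η / 2 := by
      have hGre : (G.eval (φ j u)).re ≤ -Λ' (j + K₀) := (hz₀G j (φ j u) (hdisp j u hu)).1
      have hΛ'pos : 0 ≤ Λ' (j + K₀) := by
        simp only [hΛ'_def]; positivity
      have hre0 : (G.eval (φ j u)).re ≤ 0 := hGre.trans (by linarith)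
      have hReR : |(R.eval (φ j u)).re| ≤ |Real.log ‖θ‖| + 2 := by
        have e1 : (R.eval (φ j u)).re = Real.log ‖θ‖ + (u.re + ρ.re) := by
          rw [← hz₀re j, ← Complex.add_re, ← Complex.add_re]
          congr 1
          rw [hρ_def]; ring
        rw [e1]
        have h1 := abs_re_le_norm u
        have h2 := abs_re_le_norm ρ
        have h3 := abs_add_le (Real.log ‖θ‖) (u.re + ρ.re)
        have h4 := abs_add_le u.re ρ.re
        linarith
      have h5 := hC _ hre0 hReR
      refine h5.trans_lt (lt_of_le_of_lt ?_ hjE)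
      refine mul_le_mul_of_nonneg_left (Real.exp_le_exp.2 ?_) hC0
      nlinarith
    calc ‖F j u - h u‖ = ‖(Q.eval (exp (R.eval (φ j u))) - h u) + E (φ j u)‖ := by
          rw [hF_def]; ring_nf
      _ ≤ ‖Q.eval (exp (R.eval (φ j u))) - h u‖ + ‖E (φ j u)‖ := norm_add_le _ _
      _ < η / 2 + η / 2 := add_lt_add hQterm hEterm
      _ = η := by ring
  -- persistence: zeros of `F_j` in `ball 0 1` for all large `j`
  have hzeros := eventually_exists_zero_of_unif_approx hh hhne hh0 hFdiff zero_lt_one hunif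
  obtain ⟨K₁', hK₁'⟩ := eventually_atTop.1 hzeros
  have hsol : ∀ k : ℕ, ∃ u : ℂ, ‖u‖ ≤ 1 ∧ F (k + K₁') u = 0 := by
    intro k
    obtain ⟨u, hu, hu0⟩ := hK₁' (k + K₁') (Nat.le_add_left _ _)
    rw [mem_ball, dist_zero_right] at hu
    exact ⟨u, hu.le, hu0⟩
  choose u hu1 hu0 using hsol
  -- the zeros and their bookkeeping
  refine ⟨fun k => φ (k + K₁') (u k), fun k => Λ' (k + K₁' + K₀), K₃ / (A₀ / 2), ?_,
    fun k => ⟨hu0 k, (hz₀G (k + K₁') _ (hdisp _ _ (hu1 k))).1, ?_⟩⟩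
  · have h1 := hΛ'.comp (tendsto_add_atTop_nat (K₁' + K₀))
    refine h1.congr fun k => ?_
    simp only [Function.comp_apply, add_assoc]
  · have h1 := (hz₀G (k + K₁') _ (hdisp _ _ (hu1 k))).2
    refine h1.trans (le_of_eq ?_)
    simp only [hΛ'_def]
    field_simp

/-- **Ratio form.**  Along a polynomially escaping sequence, `|Re G(t_k)| / log(2 + ‖G(t_k)‖) → ∞`
(`Re G(t_k) ≤ -L_k`, `‖G(t_k)‖ ≤ A L_k`, `L_k → ∞`). (new) -/
theorem tendsto_abs_re_div_log_of_escape {w : ℕ → ℂ} {L : ℕ → ℝ} (hL : Tendsto L atTop atTop)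
    {A : ℝ} (hre : ∀ k, (w k).re ≤ -L k) (hnorm : ∀ k, ‖w k‖ ≤ A * L k) :
    Tendsto (fun k => |(w k).re| / Real.log (2 + ‖w k‖)) atTop atTop := by
  -- compare with `L / log(2 + (|A| + 1) L)`
  have hA1 : 0 < |A| + 1 := by positivity
  have hmain : Tendsto (fun k => L k / Real.log (2 + (|A| + 1) * L k)) atTop atTop :=
    (gce_tendsto_div_log_affine (by norm_num : (1 : ℝ) < 2) hA1).comp hL
  have hev : ∀ᶠ k in atTop, 1 ≤ L k := hL.eventually_ge_atTop 1
  refine tendsto_atTop_mono' atTop ?_ hmain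
  filter_upwards [hev] with k hk
  have hLpos : 0 < L k := by linarith
  have hwn : ‖w k‖ ≤ (|A| + 1) * L k := by
    calc ‖w k‖ ≤ A * L k := hnorm k
      _ ≤ |A| * L k := mul_le_mul_of_nonneg_right (le_abs_self A) hLpos.le
      _ ≤ (|A| + 1) * L k := by nlinarith
  have hlog2 : 0 < Real.log (2 + ‖w k‖) := Real.log_pos (by linarith [norm_nonneg (w k)])
  have hlogle : Real.log (2 + ‖w k‖) ≤ Real.log (2 + (|A| + 1) * L k) :=
    Real.log_le_log (by linarith [norm_nonneg (w k)]) (by linarith)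
  have habs : L k ≤ |(w k).re| := by
    have := hre k
    rw [abs_of_nonpos (by linarith)]
    linarith
  calc L k / Real.log (2 + (|A| + 1) * L k) ≤ L k / Real.log (2 + ‖w k‖) :=
        div_le_div_of_nonneg_left hLpos.le hlog2 hlogle
    _ ≤ |(w k).re| / Real.log (2 + ‖w k‖) := div_le_div_of_nonneg_right habs hlog2.le

end Summit.Schanuel.Schanuel.Theorems
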